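import Summits.BirchSwinnertonDyer.BirchSwinnertonDyer.Theorems.ByReductionTypeAtTwoMultTransportTwistedDescentSigma
import HarnessLib

/-!
# T-42 in the kernel, generic twisted descent (LXV-a): the ∀-wrappers of file `…TwistedDescentSigma` with a
# PREDICATE `R` in place of the threaded binder `W.HasMultiplicativeReductionAtPrime 2`

Cell `bsd-2adic` (run/shared/lean/pub/bsd-2adic/), seat `bsd-2adic-t42` (BRIEF-T42), GEN 29 (memo
`t42/DESIGN-T42-ADDENDUM-33.md`, «F3a road»: Matsuno's Lemma 4.5 (i) at a GOOD ORDINARY `2` as a kernel theorem).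
HONEST FRAMING: research route; THEOREMS ONLY (no `def`, no named fact, no instance); nothing booked; nothing re-keyed;
BSD is not proved by any of this. PARTITION: X5@2 GV-transport rows whose REFERENCE curve is GOOD ORDINARY at `2`
(K4ᵐ B1·O1 `MultCongruenceTransportAtTwo`; the binder `hF3a` of p744459) × p = 2 — types-the-object-of; bears_on K4 items
19922 / 19923 (`--supports stmt-BirchSwinnertonDyer-19923`).

## What

In files XIV–XXX of the multiplicative road (`hF3b`), the reduction hypothesis `W.HasMultiplicativeReductionAtPrime 2`
of the ∀-statements `LIFT`, `LIFT₁`, `LIFT₂`, `LIFT₃`, `T2`, `δ2`, `δinf` and of the conclusion is only THREADED — it is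
consumed by the two local inputs at the end of the chain (the Tate-line package at `2`), never by the wrappers. This file
re-lands the wrappers of `…TwistedDescentSigma` with an arbitrary predicate
`R : ∀ (W : WeierstrassCurve ℚ) [W.IsElliptic] [W.IsGloballyMinimal], Prop` in place of that binder (names suffixed
`_R`, `R` the first explicit argument; statements and proofs otherwise VERBATIM). Instantiated at
`R W := IsOrdinaryAt W 2` with the good-ordinary local inputs (`…TwistedDescentOrdLinePackage`, `…OrdT2Final`) the
chain yields `Matsuno2008.lemma45i_noFiniteSubmodule_nonPrimitive_goodOrd_two` from Greenberg's Prop. 4.9; at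
`R W := W.HasMultiplicativeReductionAtPrime 2` it is the original chain.

Declarations: `hF3b_of_prop49Sigma_of_lift_R`.

References: [GreenbergLNM1716] §4 Lemma 4.6, Prop. 4.9, Props. 4.13–4.15 (pp. 105–126); [GreenbergVatsal2000] §2 pp. 14–17;
[MilneADT2006] I Thm. 4.10, Cor. 2.3.
-/


set_option autoImplicit false
set_option linter.dupNamespace false

noncomputable section

open scoped Classical

namespace Summit.BirchSwinnertonDyer.BirchSwinnertonDyer.Theorems.MultTransportTwistedDescent

open NumberField IsDedekindDomain Field WeierstrassCurve
  Literature.NumberTheory.EllipticCurves Literature.NumberTheory.EllipticCurves.GreenbergVatsal2000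
  Summit.BirchSwinnertonDyer.Rank1Residual.X2

/-- **`hF3b` from «Prop. 4.9» + «`H¹(ℚ_Σ/ℚ_∞, E[p^∞])` cofinitely generated» + «generic lifting at `2`
and `∞`».** The binder `hF3b` of `MultTransportAtTwo.multCongruenceTransportAtTwo_of_corePrint_{nonsplit,split,all}`
— VERBATIM — follows from three displayed hypotheses over `ℚ` (none asserted here):
* `P49` — Greenberg's Prop. 4.9 (p. 113, PRINTED for every `p`, no reduction hypothesis; proof
  pp. 115–118 treats `p = 2` via Lemma 4.11) in the tree's dual-datum currency: for `E/ℚ`, the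
  cyclotomic `ℤ_p`-extension `κ` with topological generator `γ`, a finite `Σ₀ ⊇` bad places prime to `p`,
  and `X_p(E/ℚ_∞)` `Λ`-torsion, EVERY Pontryagin-dual datum `(Y, toDual_Y)` (two axioms) of
  `H¹(ℚ_Σ/ℚ_∞, E[p^∞]) = unramifiedOutside (ker κ) E[p^∞] p Σ₀` has no nonzero finite `Λ`-submodule;
* `FG` — such a datum exists with `Y` finitely generated (p. 117 "Since `X` is a finitely generated
  `Λ`-module"; [Gr2] §3);
* `LIFT` — at a multiplicative `2`: the lifting (i) of file XV §3 for `H¹(ℚ_Σ/ℚ_∞, E[2^∞])`,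
  `Σ₁ = {(2)}`, holds for all but finitely many odd `u` (Prop. 4.13 + Remark for `A_u` at level `ℚ`,
  `cd₂ Γ = 1` restriction, local descent at `2` and at the real place, pp. 106–108, 122–124).
Composition of §2. [cite: GreenbergLNM1716, §4 Prop. 4.9 (p. 113), p. 117, Prop. 4.13 and Remark (pp. 122–123), pp. 123–125] -/
theorem hF3b_of_prop49Sigma_of_lift_R (R : ∀ (W : WeierstrassCurve ℚ) [W.IsElliptic] [W.IsGloballyMinimal], Prop)
    (P49 : ∀ (W : WeierstrassCurve ℚ) [W.IsElliptic] [W.IsGloballyMinimal] (p : ℕ) [Fact p.Prime]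
      (κ : ZpExtension ℚ p) (γ : absoluteGaloisGroup ℚ), κ.IsCyclotomic → κ.IsTopGenerator γ →
      ∀ (S₀ : Finset (HeightOneSpectrum (𝓞 ℚ))),
        (∀ v : HeightOneSpectrum (𝓞 ℚ), v ∉ S₀ → ((p : ℕ) : 𝓞 ℚ) ∉ v.asIdeal →
          W.HasGoodReductionAt v) →
      ∀ (D : W.SelmerDualData κ γ), D.IsTorsion →
      ∀ (Y : Type) [AddCommGroup Y] [Module (IwasawaAlgebra p) Y]
        (dY : Y →+ (unramifiedOutside κ.kerSubgroup (W.geomPrimaryTorsion p) p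
          (↑S₀ : Set (HeightOneSpectrum (𝓞 ℚ))) →+ AddCircle (1 : ℚ))),
        Function.Bijective dY →
        (∀ (y : Y) (c : unramifiedOutside κ.kerSubgroup (W.geomPrimaryTorsion p) p
            (↑S₀ : Set (HeightOneSpectrum (𝓞 ℚ)))),
          dY ((PowerSeries.X : IwasawaAlgebra p) • y) c =
            dY y ⟨W.conjH1 p κ.kerSubgroup γ c,
              conjH1_mem_unramifiedOutside κ.kerSubgroup (W.geomPrimaryTorsion p) p _ γ c.2⟩ - dY y c) →
        (∀ (a : ℤ_[p]) (y : Y) (c : unramifiedOutside κ.kerSubgroup (W.geomPrimaryTorsion p) p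
            (↑S₀ : Set (HeightOneSpectrum (𝓞 ℚ)))) (k : ℕ), (p ^ k) • c = 0 →
          dY (PowerSeries.C a • y) c = (PadicInt.toZModPow k a).val • dY y c) →
        ∀ N : Submodule (IwasawaAlgebra p) Y, Finite N → N = ⊥)
    (FG : ∀ (W : WeierstrassCurve ℚ) [W.IsElliptic] [W.IsGloballyMinimal] (p : ℕ) [Fact p.Prime]
      (κ : ZpExtension ℚ p) (γ : absoluteGaloisGroup ℚ), κ.IsCyclotomic → κ.IsTopGenerator γ →
      ∀ (S₀ : Finset (HeightOneSpectrum (𝓞 ℚ))),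
        (∀ v : HeightOneSpectrum (𝓞 ℚ), v ∉ S₀ → ((p : ℕ) : 𝓞 ℚ) ∉ v.asIdeal →
          W.HasGoodReductionAt v) →
      ∃ (Y : Type) (_ : AddCommGroup Y) (_ : Module (IwasawaAlgebra p) Y)
        (_ : Module.Finite (IwasawaAlgebra p) Y)
        (dY : Y →+ (unramifiedOutside κ.kerSubgroup (W.geomPrimaryTorsion p) p
          (↑S₀ : Set (HeightOneSpectrum (𝓞 ℚ))) →+ AddCircle (1 : ℚ))),
        Function.Bijective dY ∧
        (∀ (y : Y) (c : unramifiedOutside κ.kerSubgroup (W.geomPrimaryTorsion p) p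
            (↑S₀ : Set (HeightOneSpectrum (𝓞 ℚ)))),
          dY ((PowerSeries.X : IwasawaAlgebra p) • y) c =
            dY y ⟨W.conjH1 p κ.kerSubgroup γ c,
              conjH1_mem_unramifiedOutside κ.kerSubgroup (W.geomPrimaryTorsion p) p _ γ c.2⟩ - dY y c) ∧
        (∀ (a : ℤ_[p]) (y : Y) (c : unramifiedOutside κ.kerSubgroup (W.geomPrimaryTorsion p) p
            (↑S₀ : Set (HeightOneSpectrum (𝓞 ℚ)))) (k : ℕ), (p ^ k) • c = 0 →
          dY (PowerSeries.C a • y) c = (PadicInt.toZModPow k a).val • dY y c))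
    (LIFT : ∀ (W : WeierstrassCurve ℚ) [W.IsElliptic] [W.IsGloballyMinimal],
      R W →
      ∀ (κ : ZpExtension ℚ 2) (_hκ : κ.IsCyclotomic) (γ : absoluteGaloisGroup ℚ)
        (_hγ : κ.IsTopGenerator γ) (S₀ : Finset (HeightOneSpectrum (𝓞 ℚ)))
        (_hne : S₀.Nonempty)
        (_hS₀ : ∀ v ∈ S₀, ((2 : ℕ) : 𝓞 ℚ) ∉ v.asIdeal)
        (_hbad : ∀ v : HeightOneSpectrum (𝓞 ℚ), v ∉ S₀ → ((2 : ℕ) : 𝓞 ℚ) ∉ v.asIdeal →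
          W.HasGoodReductionAt v)
        (D : W.SelmerDualData κ γ) [Module.Finite (IwasawaAlgebra 2) D.X], D.IsTorsion →
      {u : ℤ | (2 : ℤ) ∣ u - 1 ∧
        ¬ ∀ c ∈ unramifiedOutside κ.kerSubgroup (W.geomPrimaryTorsion 2) 2
            (↑S₀ : Set (HeightOneSpectrum (𝓞 ℚ))),
        (∀ v ∈ {v : HeightOneSpectrum (𝓞 ℚ) | ((2 : ℕ) : 𝓞 ℚ) ∈ v.asIdeal}, ∀ σ : absoluteGaloisGroup ℚ,
            W.conjH1 2 κ.kerSubgroup σ (u • W.conjH1 2 κ.kerSubgroup γ c - c) ∈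
              W.localKerOver 2 κ.kerSubgroup (v.adicCompletion ℚ)) →
        (∀ (w : InfinitePlace ℚ) (σ : absoluteGaloisGroup ℚ),
            W.conjH1 2 κ.kerSubgroup σ (u • W.conjH1 2 κ.kerSubgroup γ c - c) ∈
              W.localKerOver 2 κ.kerSubgroup w.Completion) →
        ∃ c' ∈ unramifiedOutside κ.kerSubgroup (W.geomPrimaryTorsion 2) 2
            (↑S₀ : Set (HeightOneSpectrum (𝓞 ℚ))),
          u • W.conjH1 2 κ.kerSubgroup γ c' - c' = 0 ∧
          (∀ v ∈ {v : HeightOneSpectrum (𝓞 ℚ) | ((2 : ℕ) : 𝓞 ℚ) ∈ v.asIdeal},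
            ∀ σ : absoluteGaloisGroup ℚ,
              W.conjH1 2 κ.kerSubgroup σ (c' - c) ∈ W.localKerOver 2 κ.kerSubgroup (v.adicCompletion ℚ)) ∧
          (∀ (w : InfinitePlace ℚ) (σ : absoluteGaloisGroup ℚ),
              W.conjH1 2 κ.kerSubgroup σ (c' - c) ∈ W.localKerOver 2 κ.kerSubgroup w.Completion)}.Finite) :
    ∀ (W : WeierstrassCurve ℚ) [W.IsElliptic] [W.IsGloballyMinimal],
      R W →
      ∀ (κ : ZpExtension ℚ 2) (_hκ : κ.IsCyclotomic) (γ : absoluteGaloisGroup ℚ)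
        (_hγ : κ.IsTopGenerator γ) (S₀ : Finset (HeightOneSpectrum (𝓞 ℚ)))
        (_hne : S₀.Nonempty)
        (_hS₀ : ∀ v ∈ S₀, ((2 : ℕ) : 𝓞 ℚ) ∉ v.asIdeal)
        (_hbad : ∀ v : HeightOneSpectrum (𝓞 ℚ), v ∉ S₀ → ((2 : ℕ) : 𝓞 ℚ) ∉ v.asIdeal →
          W.HasGoodReductionAt v)
        (D : W.SelmerDualData κ γ) [Module.Finite (IwasawaAlgebra 2) D.X], D.IsTorsion →
        ∀ (DS : NonPrimitiveDualData W κ γ (↑S₀ : Set (HeightOneSpectrum (𝓞 ℚ))))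
          (N : Submodule (IwasawaAlgebra 2) DS.X), Finite N → N = ⊥ := by
  intro W _ _ hmult κ hκ γ hγ S₀ hne hS₀ hbad D _ hXt DS
  obtain ⟨Y, _, _, _, dY, hbij, hT, hC⟩ := FG W 2 κ γ hκ hγ S₀ hbad
  have hY := P49 W 2 κ γ hκ hγ S₀ hbad D hXt Y dY hbij hT hC
  exact forall_finite_eq_bot_nonPrimitive_of_prop49Sigma W κ hκ γ _ (fun v hv ↦ hS₀ v hv) hbad
    dY hbij hT hC hY (LIFT W hmult κ hκ γ hγ S₀ hne hS₀ hbad D hXt) DS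

end Summit.BirchSwinnertonDyer.BirchSwinnertonDyer.Theorems.MultTransportTwistedDescent

end
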